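import Literature.MathematicalPhysics.QuantumFieldTheory.Balaban1983to89.B6Hprime2101TwoScaleV1Torus
import Literature.MathematicalPhysics.QuantumFieldTheory.Balaban1983to89.B6SchurTorusBound
import Literature.MathematicalPhysics.QuantumFieldTheory.Balaban1983to89.B5G183Kernel

/-!
# `Balaban1983to89.B6HprimeOpNormV1` — T. Bałaban, *Propagators and renormalization transformations for lattice gauge theories. II*,
# Commun. Math. Phys. **96** (1984) 223–250 [Balaban1984PropagatorsII], p. 241 (text after (2.101)) and p. 246 (text after (2.132)):
# «H′_j IS A BOUNDED OPERATOR» and «DERIVATIVES OF H′_j UP TO THIRD ORDER … ARE UNIFORMLY BOUNDED» AS OPERATOR-NORM STATEMENTS FOR THE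
# CONCRETE `H′_j` OF THE TWO-SCALE V1 DATA — `‖H′_jμ‖`, `‖∂H′_jμ‖`, `‖∂ΔH′_jμ‖ ≤ C·n^{(d+1)/2}·‖μ‖` (`n = L^j`), uniformly in the volume

statement-level skeleton of published theorems with citation tags; proofs where landed; nothing here is a claim about the Yang–Mills mass gap

PDF held: `paper:balaban1984-cmp96-propagators-rt-ii` (journal page = PDF page + 222), p. 241 [PDF 19], p. 246 [PDF 24]; text layer read this
session.  PRINT (verbatim).  p. 241: *"From the momentum representation of (2.101) we may get easily that H′_j is a bounded operator with an
exponential decay, the bound and decay rate depending on d only."*  p. 246: *"… derivatives of H′_j up to third order, and their local Hölder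
norms as in (2.67), are uniformly bounded and have a uniform exponential decay with a decay rate depending on d only. All the above considerations
imply the following Proposition 2.5."*  In (2.129) `H′_j` enters through `∂H′_jC^{(j)}_ΛH′_j*∂*` and `∂ΔH′_jC^{(j)}_ΛH′_j*∂*`.

CITATION HEADER (lean-in-tree rule) — WHAT IS REPRODUCED.  Phase-2 file of the `lit-balaban` typed skeleton (HOME `run/shared/lean/pub/lit-balaban/`),
seat **p22 gen 13** (B6 fold owner r03, referee ref-4; lane = Sect. C (2.95)–(2.147) on the concrete two-scale data `tsV1`), file 2 of 4 toward the
ℓ²-BOUNDEDNESS MEMBER OF PROP. 2.5 AT TWO LEVELS; SKELETON rows **B6.Eq2.98** / **B6.Eq2.132** — until now certified at KERNEL level (r03: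
`…B6Hprime2132Torus.norm_HpOp_le`/`norm_dker_le` for the typed torus operator `HpOp`; this seat gen 9: the concrete `H′_j` of `tsV1` IS `HpOp`,
`…B6Hprime2101TwoScaleV1Torus.hP_apply_eq`); THIS FILE turns them into OPERATOR bounds for `H′_j = …B6SectCTwoScaleV1Lattice.hP hc j :
ℓ²(T^{(j)}) → ℓ²(T^{(0)})`: §1 dictionary (`EK_shift`/`EK_unshift`; `hP_eq_re`; `iterD_re_eq_sum`; the V1 first differences, Laplacian `Δ_c`
and `∂_cΔ_c` of `H′_jμ` through r03's iterated fine differences `iterD`: `mul_pdiff_hP`, `sq_mul_laplace_hP`, `cube_mul_grad_laplace_hP`; fibres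
of the block placement `card_filter_blockOf_EK_le`); §2 the CORE SCHUR STEP **`sum_sq_iterD_re_le`** (`m ≤ 3`:
`Σ_x (Re[∂^m(H′μ̃)](EK x))² ≤ (A_m·K)²·n^{d+1}·‖μ‖²`, `A_m = MGHD(d+1,m)·periodConst(κ_N(d+1), d)` r03's kernel constant,
`K = latticeConst(d+1)(κ_N(d+1)/(d+1))`, via file 1 `…B6SchurTorusBound.sum_sq_le_of_entry_decay`); §3 **`norm_hP_sq_le`**, **`norm_dE_hP_sq_le`**
(`‖∂_cH′_jμ‖² ≤ (c/n)²(d+1)(A₁K)²n^{d+1}‖μ‖²`), **`norm_dE_lapE_hP_sq_le`** (`‖∂_cΔ_cH′_jμ‖² ≤ (c/n)⁶(d+1)³(A₃K)²n^{d+1}‖μ‖²`) — UNIFORM in the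
volume `(m, K)`; the factor `n^{d+1} = L^{j(d+1)}` is the V1 normalisation (unweighted `ℓ²` of the fine lattice = `η^{−(d+1)}` × the paper's
`η`-weighted `L²`), and `c/n = 1` at the paper's scaling `c = η⁻¹`.  IMPORTS BY NAME, restating nothing: r03's `…B6Hprime2132Torus.{HpOp, iterD,
dker, iterD_succ, iterD_zero, iterD_HpOp_mulVec, norm_dker_le}`, p38's `…B5Eq117TorusCarriers.EK`, `…B5G183Kernel.exists_eq_bpt`,
`…B5Blocks16.blockOf_bpt`, `…B5Action121.sdiff_mulVec`, `…B5WalkCarrierTorus.normSq_eq`.  THEOREMS ONLY (no definition, no `def … : Prop`);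
standard axioms.  HONEST SCOPE: finite tori of the V1 calculus; §§2–3 are written for the parameter set `⟨d + 1, L, m, K, _, _⟩` (r03's torus
files index the dimension as `d + 1`; every `P : Params` has this form) with `[NeZero L]` (a consequence of `1 < L`, stated as an instance
binder); constants ours; operator bounds only (the exponential decay itself stays at kernel level in r03's files); NOT summit progress.
Unit `lit-balaban-p22` (gen 13), 2026-08-22.
-/

noncomputable section

open scoped InnerProductSpace BigOperators Matrix ComplexConjugate
open Finset

namespace Literature.MathematicalPhysics.QuantumFieldTheory.Balaban1983to89.B6HprimeOpNormV1

open LatticeFieldCalculus B5SectBStatements B5Eq117TorusCarriers B6SectAOperatorsV1 B6SectCTwoScaleV1 B6SectCTwoScaleV1Lattice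
open B5Prop11Plancherel (Tor fine)
open B5Block118 (bpt)
open B5Blocks16 (blockOf_bpt)
open B5G183Kernel (exists_eq_bpt)
open B5Action121 (sdiff sdiff_mulVec)
open B5Hk163Strip (kappaN kappaN_pos)
open B4TorusKernel (periodConst)
open B4TorusKernel.MultiPeriod (torusSupNorm)
open B4Sect5Proof (latticeConst latticeConst_nonneg)
open B6LowerBound2153Torus (toT rep toT_rep)
open B6Hprime2132Holder (MGHD CHolder2132_nonneg)
open B5Kernel166Decay (periodConst_pos)
open B6Hprime2132Torus (HpOp iterD dker iterD_succ iterD_zero iterD_HpOp_mulVec norm_dker_le)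
open B6Hprime2101TwoScaleV1Torus (hP_apply_eq transportC_apply)
open B6SchurTorusBound (sum_sq_le_of_entry_decay)
open B5WalkCarrierTorus (normSq_eq)

/-! ## §1  Dictionary: unit steps under `EK`, and the V1 operators through r03's iterated fine differences -/

section Dictionary

variable {P : Params} {c : ℝ} (hc : c ≠ 0) {j : ℕ} (hj : j ≤ P.m + P.K)

/-- `EK (x + e_μ) = EK x + e_μ` (the carrier identification `T^{(0)} ≃ Tor (L^j·Mk)` commutes with unit steps).
[cite: Balaban1984PropagatorsI, (1.18) p.20] -/
theorem EK_shift (x : Site P 0) (μ : Fin P.d) :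
    EK hj (x.shift μ) = EK hj x + B5Prop11Plancherel.unitVec (fine (P.L ^ j) (Mk P j)) μ := by
  funext ν
  rw [Pi.add_apply, EK_apply, EK_apply]
  simp only [B5Prop11Plancherel.unitVec, Site.shift]
  by_cases hν : ν = μ
  · subst hν; rw [Function.update_self, Pi.single_eq_same, map_add, map_one]
  · rw [Function.update_of_ne hν, Pi.single_eq_of_ne hν, add_zero]

/-- `EK (x − e_μ) = EK x − e_μ`. [cite: Balaban1984PropagatorsI, (1.18) p.20] -/
theorem EK_unshift (x : Site P 0) (μ : Fin P.d) :
    EK hj (x.unshift μ) = EK hj x - B5Prop11Plancherel.unitVec (fine (P.L ^ j) (Mk P j)) μ := by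
  funext ν
  rw [Pi.sub_apply, EK_apply, EK_apply]
  simp only [B5Prop11Plancherel.unitVec, Site.unshift]
  by_cases hν : ν = μ
  · subst hν; rw [Function.update_self, Pi.single_eq_same, map_sub, map_one]
  · rw [Function.update_of_ne hν, Pi.single_eq_of_ne hν, sub_zero]

/-- **`(H′_jμ)(x) = Re (HpOp·μ̃)(EK x)`** (gen 9's `hP_apply_eq`, real parts). [cite: Balaban1984PropagatorsII, (2.101) p.241] -/
theorem hP_eq_re (μ : USite P j) (x : Site P 0) :
    hP hc j μ x = ((HpOp (P.L ^ j) (Mk P j) *ᵥ cplxS (tSc (WithLp.ofLp μ))) (EK hj x)).re := by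
  rw [← hP_apply_eq hc hj μ x, Complex.ofReal_re]

/-- **`Re[∂^m(H′μ̃)](z) = Σ_y Re(∂^mH′(z, y))·μ(y)`** — the real part of r03's kernel representation `iterD_HpOp_mulVec` for a REAL `μ`.
[cite: Balaban1984PropagatorsII, p.246 («derivatives of H′_j up to third order»)] -/
theorem iterD_re_eq_sum {m : ℕ} (νs : Fin m → Fin P.d) (μ : USite P j) (z : Tor (fine (P.L ^ j) (Mk P j))) :
    (iterD (P.L ^ j) (Mk P j) m νs (HpOp (P.L ^ j) (Mk P j) *ᵥ cplxS (tSc (WithLp.ofLp μ))) z).re =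
      ∑ y : Site P j, (dker (P.L ^ j) (Mk P j) νs z y).re * μ y := by
  rw [iterD_HpOp_mulVec, Complex.re_sum]
  refine Finset.sum_congr rfl fun y _ => ?_
  rw [transportC_apply, Complex.mul_re, Complex.ofReal_re, Complex.ofReal_im, mul_zero, sub_zero]

/-- `∂_ν g (z) = n(g(z + e_ν) − g(z))` for r03's `iterD 1`. [cite: Balaban1984PropagatorsI, (1.4) p.18] -/
theorem iterD_one (g : Tor (fine (P.L ^ j) (Mk P j)) → ℂ) (ν : Fin P.d) (z : Tor (fine (P.L ^ j) (Mk P j))) :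
    iterD (P.L ^ j) (Mk P j) 1 ![ν] g z =
      ((P.L ^ j : ℕ) : ℂ) * (g (z + B5Prop11Plancherel.unitVec (fine (P.L ^ j) (Mk P j)) ν) - g z) := by
  rw [iterD_succ, sdiff_mulVec]; rfl

/-- `∂_ν∂_ν g (z) = n(∂_νg(z + e_ν) − ∂_νg(z))`. [cite: Balaban1984PropagatorsI, (1.4) p.18] -/
theorem iterD_two (g : Tor (fine (P.L ^ j) (Mk P j)) → ℂ) (ν : Fin P.d) (z : Tor (fine (P.L ^ j) (Mk P j))) :
    iterD (P.L ^ j) (Mk P j) 2 ![ν, ν] g z =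
      ((P.L ^ j : ℕ) : ℂ) * (iterD (P.L ^ j) (Mk P j) 1 ![ν] g (z + B5Prop11Plancherel.unitVec (fine (P.L ^ j) (Mk P j)) ν) -
        iterD (P.L ^ j) (Mk P j) 1 ![ν] g z) := by
  rw [iterD_succ, sdiff_mulVec, show Fin.tail ![ν, ν] = ![ν] from Fin.tail_cons _ _]; rfl

/-- `∂_{μ₀}∂_ν∂_ν g (z) = n(∂_ν∂_νg(z + e_{μ₀}) − ∂_ν∂_νg(z))`. [cite: Balaban1984PropagatorsI, (1.4) p.18] -/
theorem iterD_three (g : Tor (fine (P.L ^ j) (Mk P j)) → ℂ) (μ₀ ν : Fin P.d) (z : Tor (fine (P.L ^ j) (Mk P j))) :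
    iterD (P.L ^ j) (Mk P j) 3 ![μ₀, ν, ν] g z =
      ((P.L ^ j : ℕ) : ℂ) * (iterD (P.L ^ j) (Mk P j) 2 ![ν, ν] g (z + B5Prop11Plancherel.unitVec (fine (P.L ^ j) (Mk P j)) μ₀) -
        iterD (P.L ^ j) (Mk P j) 2 ![ν, ν] g z) := by
  rw [iterD_succ, sdiff_mulVec, show Fin.tail ![μ₀, ν, ν] = ![ν, ν] from Fin.tail_cons _ _]; rfl

/-- **first differences**: `n·[(H′_jμ)(x + e_ν) − (H′_jμ)(x)] = Re[∂_νH′μ̃](EK x)` (`∂_ν = sdiff` carries the factor `n = η⁻¹`).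
[cite: Balaban1984PropagatorsII, p.246 («derivatives of H′_j up to third order»)] -/
theorem mul_pdiff_hP (μ : USite P j) (x : Site P 0) (ν : Fin P.d) :
    ((P.L : ℝ) ^ j) * (hP hc j μ (x.shift ν) - hP hc j μ x) =
      (iterD (P.L ^ j) (Mk P j) 1 ![ν] (HpOp (P.L ^ j) (Mk P j) *ᵥ cplxS (tSc (WithLp.ofLp μ))) (EK hj x)).re := by
  rw [hP_eq_re hc hj, hP_eq_re hc hj, EK_shift hj, iterD_one]
  simp only [Complex.mul_re, Complex.sub_re, Complex.natCast_re, Complex.natCast_im, zero_mul, sub_zero]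
  push_cast
  ring

/-- **second differences / the Laplacian**: `n²·(Δ_c(H′_jμ))(x) = −c²·Σ_ν Re[∂_ν∂_νH′μ̃](EK(x − e_ν))` (the V1 Laplacian
`(Δ_cf)(x) = Σ_ν c²(2f(x) − f(x+e_ν) − f(x−e_ν))`, `…LatticeFieldCalculus.laplace`). [cite: Balaban1984PropagatorsII, p.246 («derivatives of H′_j up to third order»)] -/
theorem sq_mul_laplace_hP (μ : USite P j) (x : Site P 0) :
    ((P.L : ℝ) ^ j) ^ 2 * laplace c (WithLp.ofLp (hP hc j μ)) x =
      -(c ^ 2) * ∑ ν : Fin P.d,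
        (iterD (P.L ^ j) (Mk P j) 2 ![ν, ν] (HpOp (P.L ^ j) (Mk P j) *ᵥ cplxS (tSc (WithLp.ofLp μ))) (EK hj (x.unshift ν))).re := by
  unfold laplace
  rw [Finset.mul_sum, Finset.mul_sum]
  refine Finset.sum_congr rfl fun ν _ => ?_
  have e1 : EK hj (x.unshift ν) + B5Prop11Plancherel.unitVec (fine (P.L ^ j) (Mk P j)) ν = EK hj x := by
    rw [EK_unshift hj, sub_add_cancel]
  have e2 : EK hj x + B5Prop11Plancherel.unitVec (fine (P.L ^ j) (Mk P j)) ν = EK hj (x.shift ν) := by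
    rw [EK_shift hj]
  rw [iterD_two, iterD_one, iterD_one, e1, e2]
  simp only [smul_eq_mul]
  rw [show WithLp.ofLp (hP hc j μ) x = hP hc j μ x from rfl, show WithLp.ofLp (hP hc j μ) (x.shift ν) = hP hc j μ (x.shift ν) from rfl,
    show WithLp.ofLp (hP hc j μ) (x.unshift ν) = hP hc j μ (x.unshift ν) from rfl,
    hP_eq_re hc hj μ x, hP_eq_re hc hj μ (x.shift ν), hP_eq_re hc hj μ (x.unshift ν)]
  simp only [Complex.mul_re, Complex.sub_re, Complex.natCast_re, Complex.natCast_im, zero_mul, sub_zero]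
  push_cast
  ring

/-- **third differences / gradient of the Laplacian**: `n³·(∂_cΔ_c(H′_jμ))(x, μ₀) = −c³·Σ_ν Re[∂_{μ₀}∂_ν∂_νH′μ̃](EK(x − e_ν))`.
[cite: Balaban1984PropagatorsII, p.246 («derivatives of H′_j up to third order»)] -/
theorem cube_mul_grad_laplace_hP (μ : USite P j) (x : Site P 0) (μ₀ : Fin P.d) :
    ((P.L : ℝ) ^ j) ^ 3 * grad c (laplace c (WithLp.ofLp (hP hc j μ))) ⟨x, μ₀⟩ =
      -(c ^ 3) * ∑ ν : Fin P.d,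
        (iterD (P.L ^ j) (Mk P j) 3 ![μ₀, ν, ν] (HpOp (P.L ^ j) (Mk P j) *ᵥ cplxS (tSc (WithLp.ofLp μ))) (EK hj (x.unshift ν))).re := by
  -- `n³·c·(F(x+e_{μ₀}) − F(x))` with `n²F = −c² Σ_ν Re[∂_ν∂_ν …]`
  have key : ((P.L : ℝ) ^ j) ^ 3 * grad c (laplace c (WithLp.ofLp (hP hc j μ))) ⟨x, μ₀⟩ =
      c * ((P.L : ℝ) ^ j) * (((P.L : ℝ) ^ j) ^ 2 * laplace c (WithLp.ofLp (hP hc j μ)) (x.shift μ₀) -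
        ((P.L : ℝ) ^ j) ^ 2 * laplace c (WithLp.ofLp (hP hc j μ)) x) := by
    simp only [grad, PBond.tgt, smul_eq_mul]
    ring
  rw [key, sq_mul_laplace_hP hc hj μ (x.shift μ₀), sq_mul_laplace_hP hc hj μ x, ← mul_sub, ← Finset.sum_sub_distrib,
    Finset.mul_sum, Finset.mul_sum, Finset.mul_sum]
  refine Finset.sum_congr rfl fun ν _ => ?_
  have e3 : EK hj ((x.shift μ₀).unshift ν) = EK hj (x.unshift ν) + B5Prop11Plancherel.unitVec (fine (P.L ^ j) (Mk P j)) μ₀ := by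
    rw [EK_unshift hj, EK_shift hj, EK_unshift hj]
    abel
  rw [e3, iterD_three]
  simp only [Complex.mul_re, Complex.sub_re, Complex.natCast_re, Complex.natCast_im, zero_mul, sub_zero]
  push_cast
  ring

/-- **fibres of the block map**: at most `n^{d}` (`n = L^j`, `d = P.d`) fine sites of `T^{(0)}` lie over a unit site of `T^{(j)}` (in fact
exactly: p09/p38's `bpt_bijective`; only the bound is needed). [cite: Balaban1984PropagatorsI, (1.18) p.20] -/
theorem card_filter_blockOf_EK_le (t : Site P j) :
    (Finset.univ.filter fun x : Site P 0 => B5Blocks16.blockOf (P.L ^ j) (Mk P j) (EK hj x) = t).card ≤ (P.L ^ j) ^ P.d := by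
  classical
  have hsub : (Finset.univ.filter fun x : Site P 0 => B5Blocks16.blockOf (P.L ^ j) (Mk P j) (EK hj x) = t) ⊆
      (Finset.univ : Finset (Fin P.d → Fin (P.L ^ j))).image (fun r => (EK hj).symm (bpt (P.L ^ j) (Mk P j) t r)) := by
    intro x hx; rw [Finset.mem_filter] at hx
    obtain ⟨y', r, h⟩ := exists_eq_bpt (P.L ^ j) (Mk P j) (EK hj x)
    have hy' : y' = t := by rw [← hx.2, h, blockOf_bpt]
    refine Finset.mem_image.2 ⟨r, Finset.mem_univ _, ?_⟩
    rw [← hy', ← h, Equiv.symm_apply_apply]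
  calc (Finset.univ.filter fun x : Site P 0 => B5Blocks16.blockOf (P.L ^ j) (Mk P j) (EK hj x) = t).card
      ≤ ((Finset.univ : Finset (Fin P.d → Fin (P.L ^ j))).image
          (fun r => (EK hj).symm (bpt (P.L ^ j) (Mk P j) t r))).card := Finset.card_le_card hsub
    _ ≤ (Finset.univ : Finset (Fin P.d → Fin (P.L ^ j))).card := Finset.card_image_le
    _ = (P.L ^ j) ^ P.d := by rw [Finset.card_univ, Fintype.card_fun, Fintype.card_fin, Fintype.card_fin]

omit hj in
/-- fibres of the identity placement of the unit sites: one. [cite: Balaban1984PropagatorsI, (1.18) p.20] -/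
theorem card_filter_eq_le_one (t : Site P j) : (Finset.univ.filter fun k : Site P j => k = t).card ≤ 1 := by
  rw [Finset.filter_eq' Finset.univ t, if_pos (Finset.mem_univ _), Finset.card_singleton]

end Dictionary

/-! ## §2  The core Schur step: `Σ_x (Re[∂^m(H′μ̃)](EK x))² ≤ (A_m·K)²·n^{d+1}·‖μ‖²`, `m ≤ 3` -/

section Core

variable {d L m K : ℕ} [NeZero L] {hd : 1 ≤ d + 1} {hL : Odd L ∧ 1 < L} {c : ℝ} (hc : c ≠ 0) {j : ℕ}
  (hj : j ≤ (⟨d + 1, L, m, K, hd, hL⟩ : Params).m + (⟨d + 1, L, m, K, hd, hL⟩ : Params).K)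

/-- **THE CORE SCHUR STEP** for the concrete `H′_j` and its fine derivatives up to order three: for `m ≤ 3` directions `νs` and every
unit-lattice function `μ`, `Σ_{x∈T^{(0)}} (Re[∂^{m}_{νs}(H′μ̃)](EK x))² ≤ (A_m·K_{d+1})²·n^{d+1}·‖μ‖²`, `A_m = MGHD(d+1,m)·periodConst(κ_N(d+1),d)`
(r03's `norm_dker_le`), `K_{d+1} = latticeConst(d+1)(κ_N(d+1)/(d+1))`, `n = L^j` — uniformly in the volume `(m, K)`.
[cite: Balaban1984PropagatorsII, p.246 («derivatives of H′_j up to third order … are uniformly bounded»)] -/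
theorem sum_sq_iterD_re_le {mo : ℕ} (hmo : mo ≤ 3) (νs : Fin mo → Fin (d + 1))
    (μ : USite (⟨d + 1, L, m, K, hd, hL⟩ : Params) j) :
    ∑ x : Site (⟨d + 1, L, m, K, hd, hL⟩ : Params) 0,
      (iterD ((⟨d + 1, L, m, K, hd, hL⟩ : Params).L ^ j) (Mk ⟨d + 1, L, m, K, hd, hL⟩ j) mo νs
        (HpOp ((⟨d + 1, L, m, K, hd, hL⟩ : Params).L ^ j) (Mk ⟨d + 1, L, m, K, hd, hL⟩ j) *ᵥ cplxS (tSc (WithLp.ofLp μ)))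
          (EK hj x)).re ^ 2 ≤
      (MGHD (d + 1) mo * periodConst (kappaN (d + 1)) d * latticeConst (d + 1) (kappaN (d + 1) / (d + 1))) ^ 2 *
        ((L : ℝ) ^ j) ^ (d + 1) * ‖μ‖ ^ 2 := by
  have ha : 0 < kappaN (d + 1) / (d + 1) := div_pos (kappaN_pos _) (by positivity)
  -- the entry bound from r03's kernel theorem, the row position being the block of the fine point
  have hT : ∀ (x : Site (⟨d + 1, L, m, K, hd, hL⟩ : Params) 0) (y : Site (⟨d + 1, L, m, K, hd, hL⟩ : Params) j),
      |(dker ((⟨d + 1, L, m, K, hd, hL⟩ : Params).L ^ j) (Mk ⟨d + 1, L, m, K, hd, hL⟩ j) νs (EK hj x) y).re| ≤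
        (MGHD (d + 1) mo * periodConst (kappaN (d + 1)) d) *
          Real.exp (-(kappaN (d + 1) / (d + 1) * torusSupNorm (Mk ⟨d + 1, L, m, K, hd, hL⟩ j)
            (rep (Mk ⟨d + 1, L, m, K, hd, hL⟩ j) (B5Blocks16.blockOf ((⟨d + 1, L, m, K, hd, hL⟩ : Params).L ^ j)
              (Mk ⟨d + 1, L, m, K, hd, hL⟩ j) (EK hj x)) - rep (Mk ⟨d + 1, L, m, K, hd, hL⟩ j) y))) := by
    intro x y
    obtain ⟨y', r, h⟩ := exists_eq_bpt ((⟨d + 1, L, m, K, hd, hL⟩ : Params).L ^ j) (Mk ⟨d + 1, L, m, K, hd, hL⟩ j) (EK hj x)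
    have hb : B5Blocks16.blockOf ((⟨d + 1, L, m, K, hd, hL⟩ : Params).L ^ j) (Mk ⟨d + 1, L, m, K, hd, hL⟩ j) (EK hj x) = y' := by
      rw [h, blockOf_bpt]
    rw [hb, h]
    have h2 := norm_dker_le ((⟨d + 1, L, m, K, hd, hL⟩ : Params).L ^ j) (Mk ⟨d + 1, L, m, K, hd, hL⟩ j) r νs hmo
      (rep (Mk ⟨d + 1, L, m, K, hd, hL⟩ j) y') (rep (Mk ⟨d + 1, L, m, K, hd, hL⟩ j) y)
    rw [toT_rep, toT_rep] at h2; exact (Complex.abs_re_le_norm _).trans h2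
  have hA : 0 ≤ MGHD (d + 1) mo * periodConst (kappaN (d + 1)) d := by
    refine mul_nonneg ?_ (periodConst_pos (kappaN_pos _) _).le
    unfold MGHD
    exact mul_nonneg (pow_nonneg (Real.exp_pos 1).le _) (CHolder2132_nonneg _ _ _)
  have h := sum_sq_le_of_entry_decay (Mk ⟨d + 1, L, m, K, hd, hL⟩ j)
    (fun (x : Site (⟨d + 1, L, m, K, hd, hL⟩ : Params) 0) (y : Site (⟨d + 1, L, m, K, hd, hL⟩ : Params) j) =>
      (dker ((⟨d + 1, L, m, K, hd, hL⟩ : Params).L ^ j) (Mk ⟨d + 1, L, m, K, hd, hL⟩ j) νs (EK hj x) y).re)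
    (fun x => B5Blocks16.blockOf ((⟨d + 1, L, m, K, hd, hL⟩ : Params).L ^ j) (Mk ⟨d + 1, L, m, K, hd, hL⟩ j) (EK hj x)) (fun y => y)
    (card_filter_blockOf_EK_le hj) (card_filter_eq_le_one (P := (⟨d + 1, L, m, K, hd, hL⟩ : Params)) (j := j)) hA ha hT
    (fun y => μ y)
  calc ∑ x : Site (⟨d + 1, L, m, K, hd, hL⟩ : Params) 0,
        (iterD ((⟨d + 1, L, m, K, hd, hL⟩ : Params).L ^ j) (Mk ⟨d + 1, L, m, K, hd, hL⟩ j) mo νs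
          (HpOp ((⟨d + 1, L, m, K, hd, hL⟩ : Params).L ^ j) (Mk ⟨d + 1, L, m, K, hd, hL⟩ j) *ᵥ cplxS (tSc (WithLp.ofLp μ)))
            (EK hj x)).re ^ 2
      = ∑ x : Site (⟨d + 1, L, m, K, hd, hL⟩ : Params) 0, (∑ y : Site (⟨d + 1, L, m, K, hd, hL⟩ : Params) j,
          (dker ((⟨d + 1, L, m, K, hd, hL⟩ : Params).L ^ j) (Mk ⟨d + 1, L, m, K, hd, hL⟩ j) νs (EK hj x) y).re * μ y) ^ 2 := by
        refine Finset.sum_congr rfl fun x _ => ?_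
        exact congrArg (fun t : ℝ => t ^ 2) (iterD_re_eq_sum νs μ (EK hj x))
    _ ≤ (MGHD (d + 1) mo * periodConst (kappaN (d + 1)) d * latticeConst (d + 1) (kappaN (d + 1) / (d + 1))) ^ 2 *
          ((((⟨d + 1, L, m, K, hd, hL⟩ : Params).L ^ j) ^ (⟨d + 1, L, m, K, hd, hL⟩ : Params).d : ℕ) * (1 : ℕ)) *
          ∑ y : Site (⟨d + 1, L, m, K, hd, hL⟩ : Params) j, μ y ^ 2 := h
    _ = (MGHD (d + 1) mo * periodConst (kappaN (d + 1)) d * latticeConst (d + 1) (kappaN (d + 1) / (d + 1))) ^ 2 *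
          ((L : ℝ) ^ j) ^ (d + 1) * ‖μ‖ ^ 2 := by
        rw [normSq_eq μ]
        push_cast
        ring

/-! ## §3  The operator bounds: `‖H′_jμ‖`, `‖∂_cH′_jμ‖`, `‖∂_cΔ_cH′_jμ‖` -/

include hj

/-- **«H′_j IS A BOUNDED OPERATOR» (p. 241) for the concrete `H′_j` of the two-scale V1 data**: `‖H′_jμ‖² ≤ (A₀K)²·n^{d+1}·‖μ‖²`,
`A₀ = MGHD(d+1,0)·periodConst(κ_N(d+1),d)`, `K = latticeConst(d+1)(κ_N(d+1)/(d+1))`, `n = L^j` — uniformly in the volume.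
[cite: Balaban1984PropagatorsII, p.241, text after (2.101)] -/
theorem norm_hP_sq_le (μ : USite (⟨d + 1, L, m, K, hd, hL⟩ : Params) j) :
    ‖hP hc j μ‖ ^ 2 ≤
      (MGHD (d + 1) 0 * periodConst (kappaN (d + 1)) d * latticeConst (d + 1) (kappaN (d + 1) / (d + 1))) ^ 2 *
        ((L : ℝ) ^ j) ^ (d + 1) * ‖μ‖ ^ 2 := by
  rw [normSq_eq (hP hc j μ)]
  have h := sum_sq_iterD_re_le hj (mo := 0) (Nat.zero_le _) ![] μ
  refine le_trans (le_of_eq (Finset.sum_congr rfl fun x _ => ?_)) h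
  rw [hP_eq_re hc hj μ x, iterD_zero]

/-- **«∇H′_j … UNIFORMLY BOUNDED» for the concrete data**: `‖∂_c(H′_jμ)‖² ≤ (c/n)²·(d+1)·(A₁K)²·n^{d+1}·‖μ‖²` (`∂_c = dE c`, the fine gradient
of the V1 calculus with factor `c`; at the paper's scaling `c = n = η⁻¹`). [cite: Balaban1984PropagatorsII, p.246, text after (2.132)] -/
theorem norm_dE_hP_sq_le (μ : USite (⟨d + 1, L, m, K, hd, hL⟩ : Params) j) :
    ‖dE c (hP hc j μ)‖ ^ 2 ≤
      (c / (L : ℝ) ^ j) ^ 2 * ((d + 1 : ℝ) *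
        ((MGHD (d + 1) 1 * periodConst (kappaN (d + 1)) d * latticeConst (d + 1) (kappaN (d + 1) / (d + 1))) ^ 2 *
          ((L : ℝ) ^ j) ^ (d + 1) * ‖μ‖ ^ 2)) := by
  have hn : ((L : ℝ) ^ j) ≠ 0 := pow_ne_zero _ (Nat.cast_ne_zero.2 (NeZero.ne L))
  have hb : ∑ b : PBond (⟨d + 1, L, m, K, hd, hL⟩ : Params) 0, (dE c (hP hc j μ) b) ^ 2 =
      ∑ x : Site (⟨d + 1, L, m, K, hd, hL⟩ : Params) 0, ∑ ν : Fin (d + 1), (c * (hP hc j μ (x.shift ν) - hP hc j μ x)) ^ 2 := by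
    rw [← Fintype.sum_prod_type']
    exact (Fintype.sum_equiv (LatticeFieldCalculus.bondEquiv) _ _ fun p => rfl).symm
  calc ‖dE c (hP hc j μ)‖ ^ 2 = ∑ b : PBond (⟨d + 1, L, m, K, hd, hL⟩ : Params) 0, (dE c (hP hc j μ) b) ^ 2 := normSq_eq _
    _ = ∑ x : Site (⟨d + 1, L, m, K, hd, hL⟩ : Params) 0, ∑ ν : Fin (d + 1), (c * (hP hc j μ (x.shift ν) - hP hc j μ x)) ^ 2 := hb
    _ = (c / (L : ℝ) ^ j) ^ 2 * ∑ ν : Fin (d + 1), ∑ x : Site (⟨d + 1, L, m, K, hd, hL⟩ : Params) 0,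
          (iterD ((⟨d + 1, L, m, K, hd, hL⟩ : Params).L ^ j) (Mk ⟨d + 1, L, m, K, hd, hL⟩ j) 1 ![ν]
            (HpOp ((⟨d + 1, L, m, K, hd, hL⟩ : Params).L ^ j) (Mk ⟨d + 1, L, m, K, hd, hL⟩ j) *ᵥ cplxS (tSc (WithLp.ofLp μ)))
              (EK hj x)).re ^ 2 := by
        rw [Finset.sum_comm, Finset.mul_sum]
        refine Finset.sum_congr rfl fun ν _ => ?_
        rw [Finset.mul_sum]
        refine Finset.sum_congr rfl fun x _ => ?_
        rw [← mul_pdiff_hP hc hj μ x ν]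
        field_simp
    _ ≤ (c / (L : ℝ) ^ j) ^ 2 * ∑ _ν : Fin (d + 1),
          (MGHD (d + 1) 1 * periodConst (kappaN (d + 1)) d * latticeConst (d + 1) (kappaN (d + 1) / (d + 1))) ^ 2 *
            ((L : ℝ) ^ j) ^ (d + 1) * ‖μ‖ ^ 2 := by
        gcongr with ν
        exact sum_sq_iterD_re_le hj (mo := 1) (by norm_num) ![ν] μ
    _ = _ := by rw [Finset.sum_const, Finset.card_univ, Fintype.card_fin, nsmul_eq_mul]; push_cast; ring

/-- **«DERIVATIVES OF H′_j UP TO THIRD ORDER … UNIFORMLY BOUNDED» for the concrete data, the member used in (2.129)**: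
`‖∂_cΔ_c(H′_jμ)‖² ≤ (c/n)⁶·(d+1)³·(A₃K)²·n^{d+1}·‖μ‖²` (`Δ_c = lapE c` the fine Laplacian, `∂_c = dE c`; `K2 = ∂ΔH′_jC^{(j)}_ΛH′_j*∂*`).
[cite: Balaban1984PropagatorsII, p.246, text after (2.132)] -/
theorem norm_dE_lapE_hP_sq_le (μ : USite (⟨d + 1, L, m, K, hd, hL⟩ : Params) j) :
    ‖dE c (lapE c (hP hc j μ))‖ ^ 2 ≤
      (c / (L : ℝ) ^ j) ^ 6 * ((d + 1 : ℝ) ^ 3 *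
        ((MGHD (d + 1) 3 * periodConst (kappaN (d + 1)) d * latticeConst (d + 1) (kappaN (d + 1) / (d + 1))) ^ 2 *
          ((L : ℝ) ^ j) ^ (d + 1) * ‖μ‖ ^ 2)) := by
  have hn : ((L : ℝ) ^ j) ≠ 0 := pow_ne_zero _ (Nat.cast_ne_zero.2 (NeZero.ne L))
  -- abbreviation-free: `R μ₀ ν z = Re[∂_{μ₀}∂_ν∂_ν(H′μ̃)](EK z)`
  have hb : ∑ b : PBond (⟨d + 1, L, m, K, hd, hL⟩ : Params) 0, (dE c (lapE c (hP hc j μ)) b) ^ 2 =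
      ∑ x : Site (⟨d + 1, L, m, K, hd, hL⟩ : Params) 0, ∑ μ₀ : Fin (d + 1),
        (grad c (laplace c (WithLp.ofLp (hP hc j μ))) ⟨x, μ₀⟩) ^ 2 := by
    rw [← Fintype.sum_prod_type']
    refine (Fintype.sum_equiv (LatticeFieldCalculus.bondEquiv) _ _ fun p => ?_).symm
    rw [dE_apply, ofLp_lapE]
    rfl
  have hpt : ∀ (x : Site (⟨d + 1, L, m, K, hd, hL⟩ : Params) 0) (μ₀ : Fin (d + 1)),
      (grad c (laplace c (WithLp.ofLp (hP hc j μ))) ⟨x, μ₀⟩) ^ 2 =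
        (c / (L : ℝ) ^ j) ^ 6 * (∑ ν : Fin (d + 1),
          (iterD ((⟨d + 1, L, m, K, hd, hL⟩ : Params).L ^ j) (Mk ⟨d + 1, L, m, K, hd, hL⟩ j) 3 ![μ₀, ν, ν]
            (HpOp ((⟨d + 1, L, m, K, hd, hL⟩ : Params).L ^ j) (Mk ⟨d + 1, L, m, K, hd, hL⟩ j) *ᵥ cplxS (tSc (WithLp.ofLp μ)))
              (EK hj (x.unshift ν))).re) ^ 2 := by
    intro x μ₀
    have h3 := cube_mul_grad_laplace_hP hc hj μ x μ₀
    have hg : grad c (laplace c (WithLp.ofLp (hP hc j μ))) ⟨x, μ₀⟩ =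
        -(c ^ 3 / ((L : ℝ) ^ j) ^ 3) * ∑ ν : Fin (d + 1),
          (iterD ((⟨d + 1, L, m, K, hd, hL⟩ : Params).L ^ j) (Mk ⟨d + 1, L, m, K, hd, hL⟩ j) 3 ![μ₀, ν, ν]
            (HpOp ((⟨d + 1, L, m, K, hd, hL⟩ : Params).L ^ j) (Mk ⟨d + 1, L, m, K, hd, hL⟩ j) *ᵥ cplxS (tSc (WithLp.ofLp μ)))
              (EK hj (x.unshift ν))).re := by
      have hn3 : ((L : ℝ) ^ j) ^ 3 ≠ 0 := pow_ne_zero _ hn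
      field_simp
      push_cast at h3; linarith
    rw [hg]; ring
  calc ‖dE c (lapE c (hP hc j μ))‖ ^ 2
      = ∑ b : PBond (⟨d + 1, L, m, K, hd, hL⟩ : Params) 0, (dE c (lapE c (hP hc j μ)) b) ^ 2 := normSq_eq _
    _ = ∑ x : Site (⟨d + 1, L, m, K, hd, hL⟩ : Params) 0, ∑ μ₀ : Fin (d + 1),
          (c / (L : ℝ) ^ j) ^ 6 * (∑ ν : Fin (d + 1),
            (iterD ((⟨d + 1, L, m, K, hd, hL⟩ : Params).L ^ j) (Mk ⟨d + 1, L, m, K, hd, hL⟩ j) 3 ![μ₀, ν, ν]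
              (HpOp ((⟨d + 1, L, m, K, hd, hL⟩ : Params).L ^ j) (Mk ⟨d + 1, L, m, K, hd, hL⟩ j) *ᵥ cplxS (tSc (WithLp.ofLp μ)))
                (EK hj (x.unshift ν))).re) ^ 2 := by
        rw [hb]
        exact Finset.sum_congr rfl fun x _ => Finset.sum_congr rfl fun μ₀ _ => hpt x μ₀
    _ ≤ ∑ x : Site (⟨d + 1, L, m, K, hd, hL⟩ : Params) 0, ∑ μ₀ : Fin (d + 1),
          (c / (L : ℝ) ^ j) ^ 6 * ((Finset.univ : Finset (Fin (d + 1))).card * ∑ ν : Fin (d + 1),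
            (iterD ((⟨d + 1, L, m, K, hd, hL⟩ : Params).L ^ j) (Mk ⟨d + 1, L, m, K, hd, hL⟩ j) 3 ![μ₀, ν, ν]
              (HpOp ((⟨d + 1, L, m, K, hd, hL⟩ : Params).L ^ j) (Mk ⟨d + 1, L, m, K, hd, hL⟩ j) *ᵥ cplxS (tSc (WithLp.ofLp μ)))
                (EK hj (x.unshift ν))).re ^ 2) := by
        gcongr with x _ μ₀ _
        exact sq_sum_le_card_mul_sum_sq
    _ = (c / (L : ℝ) ^ j) ^ 6 * ((d + 1 : ℝ) * ∑ μ₀ : Fin (d + 1), ∑ ν : Fin (d + 1),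
          ∑ x : Site (⟨d + 1, L, m, K, hd, hL⟩ : Params) 0,
            (iterD ((⟨d + 1, L, m, K, hd, hL⟩ : Params).L ^ j) (Mk ⟨d + 1, L, m, K, hd, hL⟩ j) 3 ![μ₀, ν, ν]
              (HpOp ((⟨d + 1, L, m, K, hd, hL⟩ : Params).L ^ j) (Mk ⟨d + 1, L, m, K, hd, hL⟩ j) *ᵥ cplxS (tSc (WithLp.ofLp μ)))
                (EK hj x)).re ^ 2) := by
        rw [Finset.card_univ, Fintype.card_fin]
        push_cast
        simp only [Finset.mul_sum]
        rw [Finset.sum_comm]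
        refine Finset.sum_congr rfl fun μ₀ _ => ?_
        rw [Finset.sum_comm]
        refine Finset.sum_congr rfl fun ν _ => ?_
        refine Fintype.sum_equiv (LatticeFieldCalculus.shiftEquiv ν).symm _ _ fun x => ?_
        have he : (LatticeFieldCalculus.shiftEquiv (P := (⟨d + 1, L, m, K, hd, hL⟩ : Params)) (j := 0) ν).symm x =
            x.unshift ν := rfl
        rw [he]
    _ ≤ (c / (L : ℝ) ^ j) ^ 6 * ((d + 1 : ℝ) * ∑ _μ₀ : Fin (d + 1), ∑ _ν : Fin (d + 1),
          (MGHD (d + 1) 3 * periodConst (kappaN (d + 1)) d * latticeConst (d + 1) (kappaN (d + 1) / (d + 1))) ^ 2 *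
            ((L : ℝ) ^ j) ^ (d + 1) * ‖μ‖ ^ 2) := by
        gcongr with μ₀ _ ν _
        exact sum_sq_iterD_re_le hj (mo := 3) le_rfl ![μ₀, ν, ν] μ
    _ = _ := by
        simp only [Finset.sum_const, Finset.card_univ, Fintype.card_fin, nsmul_eq_mul]
        push_cast
        ring

end Core



end Literature.MathematicalPhysics.QuantumFieldTheory.Balaban1983to89.B6HprimeOpNormV1

end
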